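import Literature.AlgebraicGeometry.HodgeTheory.RigidityScalarDiffeoInvariant
import Literature.AlgebraicGeometry.Motives.AbelianVarietyProjectiveChart
import HarnessLib

/-!
# The torus Hodge model of record of a uniformised abelian variety: dimension bookkeeping, and ONE
# rigidity scalar for all uniformised abelian varieties of dimension `g`

Family `hodge`, layer `Literature/AlgebraicGeometry/HodgeTheory`, namespace
`Literature.AlgebraicGeometry.HodgeTheory` (cell hodgecm-mathlib, seat B-p13 (g16); adapter for the N3-core
assembler of the U-e P4 node, B-p03 (g14) NODS #8, 2026-08-29).  THEOREMS ONLY: no definition, no named fact,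
no instance, no notation.

## What and why

A complex abelian variety `A` uniformised by a complex torus — `φ : E/Φ(ℤ^ι) → A(ℂ)` an analytification
with model `E = ℂᵍ` (`IsAnalytification (Fin g → ℂ) A.X A.dim φ`, the output currency of the framed
uniformisations of the universal family, Summits `ue_P4b1a_flatFrameUniformisations_holds`) — carries the
**torus Hodge model of record**
`B₀ = ⟨Fin g → ℂ, ComplexTorus Φ, φ, hφ, e₀, he₀, ComplexTorus.isInternal_hodgePQ Φ⟩ : HodgeModel A.dim A.X`
for a fixed natural de Rham comparison family `e₀` over `ℂᵍ`-manifolds (in the application the family of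
record `(integrationDeRhamIsoFamily (Fin g → ℂ)).complexify`).  Its dimension INDEX is `A.dim`, which is
`g` only propositionally (`dim_eq_of_isAnalytification_pi`: `dim_ℂ ℂᵍ = A.dim` is a field of
`IsAnalytification`).  The comparison `HodgeModel.inducedIso B B₀ h` induced from a second Hodge model `B`
(of a variety of dimension `m ≥ A.dim`, in the application `ℙᴷ`) through the cylinder
`M × ℝ^{2m - 2·A.dim}` depends on that index, so the UNIFORM rigidity scalar of
`exists_ne_zero_forall_torusModel_deRham_eq_smul_inducedIso` (one index `n`, file
`RigidityScalarDiffeoInvariant`) has to be transported along `g = A.dim` before it can be fed, fibre by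
fibre, to consumers stated at the index `A.dim` (the explicit-scalar Chern–Weil/topological bridges).  The
transport is a `subst` (`torusModel_deRham_eq_smul_inducedIso_of_dim_eq`), and the result is
**`exists_ne_zero_forall_abelianVariety_torusModel_deRham_eq_smul_inducedIso`**: for fixed
`(g, ι, e₀, B, k)` and one anchor, ONE `r ≠ 0` with `e₀ = r • inducedIso B B₀(A, Φ, φ) hAm` in degree `k` on
`ComplexTorus Φ` for EVERY uniformised abelian variety `(A, Φ, φ, hφ)` of dimension `g` and every proof
`hAm : A.dim ≤ m` — the scalar quantified before the fibre datum, at the fibre's own index.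

Sources: the dimension of the model space of `X^an` is the dimension of `X` [SerreGAGA1956, §2 n°6
Prop. 3]; abelian varieties are smooth projective [MumfordAV1970, §4 (ii), §6 Application 1 (p. 62)]; the
transport of comparison scalars is functoriality of the de Rham isomorphism [BottTu1982Forms, §I.5].

## Results

* §1 `dim_eq_of_isAnalytification_pi`, `isAnalytification_pi_of_dim`, `AbelianVariety.dim_eq_of_isAnalytification_pi`,
  `AbelianVariety.isSmoothProjective_of_dim_eq`, `AbelianVariety.isSmoothProjective_of_isAnalytification_pi`.
* §2 `torusModel_deRham_eq_smul_inducedIso_of_dim_eq` (index transport of the scalar relation).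
* §3 `exists_ne_zero_forall_abelianVariety_torusModel_deRham_eq_smul_inducedIso` (the fibre-indexed uniform
  scalar).
-/

noncomputable section

open scoped Manifold ContDiff
open CategoryTheory
open Literature.NumberTheory.Transcendental (IsAnalytification complexDeRhamCohomology ComplexDeRhamIsoFamily)
open Literature.AlgebraicTopology.SingularHomology (singularCohomology)
open Literature.Geometry.Kaehler (ComplexTorus)
open Literature.AlgebraicGeometry.Motives (AbelianVariety IsSmoothProjective)

namespace Literature.AlgebraicGeometry.HodgeTheory

/-! ### §1 Dimension bookkeeping for torus-uniformised varieties -/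

section Dimension

variable {g d : ℕ} {M : Type*} [TopologicalSpace M] [ChartedSpace (Fin g → ℂ) M]
  {X : Motives.SchemeOver ℂ} {φ : M → Motives.ComplexPoints X}

/-- An analytification with model `ℂᵍ` has dimension index `g` (`dim_ℂ ℂᵍ = d` is a field of
`IsAnalytification`). [cite: SerreGAGA1956, §2 n°6 Prop. 3] -/
theorem dim_eq_of_isAnalytification_pi (hφ : IsAnalytification (Fin g → ℂ) X d φ) : d = g := by
  have h := hφ.finrank_eq
  rw [Module.finrank_fin_fun] at h
  exact h.symm

/-- Re-indexing an analytification with model `ℂᵍ` at the index `g`. [cite: SerreGAGA1956, §2 n°6 Prop. 3] -/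
theorem isAnalytification_pi_of_dim (hφ : IsAnalytification (Fin g → ℂ) X d φ) :
    IsAnalytification (Fin g → ℂ) X g φ :=
  dim_eq_of_isAnalytification_pi hφ ▸ hφ

end Dimension

section AbelianVarietyDimension

variable {g : ℕ} {M : Type*} [TopologicalSpace M] [ChartedSpace (Fin g → ℂ) M]
  {A : AbelianVariety ℂ} {φ : M → A.Points ℂ}

/-- A complex abelian variety uniformised with model `ℂᵍ` has dimension `g`.
[cite: SerreGAGA1956, §2 n°6 Prop. 3] [cite: MumfordAV1970, §1 (1) (p. 2)] -/
theorem AbelianVariety.dim_eq_of_isAnalytification_pi (hφ : IsAnalytification (Fin g → ℂ) A.X A.dim φ) :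
    A.dim = g :=
  HodgeTheory.dim_eq_of_isAnalytification_pi hφ

/-- An abelian variety of dimension `g` is smooth projective of dimension `g` (re-indexing of
`AbelianVariety.isSmoothProjective_holds`). [cite: MumfordAV1970, §4 (ii) and §6 Application 1 (p. 62)] -/
theorem AbelianVariety.isSmoothProjective_of_dim_eq (h : A.dim = g) : IsSmoothProjective g A.X :=
  h ▸ (Motives.AbelianVariety.isSmoothProjective_holds : IsSmoothProjective A.dim A.X)

/-- A complex abelian variety uniformised with model `ℂᵍ` is smooth projective of dimension `g`.
[cite: MumfordAV1970, §4 (ii) and §6 Application 1 (p. 62)] [cite: SerreGAGA1956, §2 n°6 Prop. 3] -/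
theorem AbelianVariety.isSmoothProjective_of_isAnalytification_pi
    (hφ : IsAnalytification (Fin g → ℂ) A.X A.dim φ) : IsSmoothProjective g A.X :=
  AbelianVariety.isSmoothProjective_of_dim_eq (AbelianVariety.dim_eq_of_isAnalytification_pi hφ)

end AbelianVarietyDimension

/-! ### §2 Transport of the scalar relation along an equality of dimension indices -/

section IndexTransport

variable {E : Type} [NormedAddCommGroup E] [NormedSpace ℂ E] [FiniteDimensional ℂ E]
  {M : Type} [TopologicalSpace M] [ChartedSpace E M] [IsManifold 𝓘(ℂ, E) ω M] [IsManifold 𝓘(ℝ, E) ∞ M]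
  [T2Space M] [SigmaCompactSpace M]
  {X Y : Motives.SchemeOver ℂ} {n n' m : ℕ}

/-- **Index transport.**  The scalar relation `e = r • inducedIso B ⟨E, M, φ, hφ, e, …⟩ hnm` for a Hodge model
literal of `X` at the dimension index `n` is the same relation for the re-indexed literal
`⟨E, M, φ, hn ▸ hφ, e, …⟩` at any propositionally equal index `n′` and any proof `hn′m : n′ ≤ m` (the
cylinder `M × ℝ^{2m-2n}` of `HodgeModel.inducedIso` depends on the index; `subst`). [cite: BottTu1982Forms, §I.5] -/
theorem torusModel_deRham_eq_smul_inducedIso_of_dim_eq (B : HodgeModel m Y) (φ : M → Motives.ComplexPoints X)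
    (hφ : IsAnalytification E X n φ) (e : ComplexDeRhamIsoFamily E) (he : e.IsNatural)
    (hint : ∀ k : ℕ, DirectSum.IsInternal fun pq : ↥(Finset.HasAntidiagonal.antidiagonal k) ↦
      Literature.NumberTheory.Transcendental.hodgePQ E M k pq.1.1 pq.1.2)
    (hn : n = n') (hnm : n ≤ m) (hn'm : n' ≤ m) (k : ℕ) {r : ℂ}
    (hr : ∀ y : complexDeRhamCohomology E M k,
      e M k y = r • HodgeModel.inducedIso B
        ({ model := E, carrier := M, toComplexPoints := φ, isAnalytification := hφ, deRham := e,
           deRham_isNatural := he, isInternal_hodgePQ := hint } : HodgeModel n X) hnm M k y) :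
    ∀ y : complexDeRhamCohomology E M k,
      e M k y = r • HodgeModel.inducedIso B
        ({ model := E, carrier := M, toComplexPoints := φ, isAnalytification := hn ▸ hφ, deRham := e,
           deRham_isNatural := he, isInternal_hodgePQ := hint } : HodgeModel n' X) hn'm M k y := by
  subst hn
  exact hr

end IndexTransport

/-! ### §3 One rigidity scalar for all uniformised abelian varieties of dimension `g` -/

section Uniform

variable {g : ℕ} {ι : Type} [Fintype ι] {m : ℕ} {Y : Motives.SchemeOver ℂ}

/-- **ONE non-zero rigidity scalar for all torus-uniformised complex abelian varieties of dimension `g`, at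
the fibre's own index `A.dim`.**  Fix `g`, an index type `ι`, a natural comparison family `e₀` over
`ℂᵍ`-manifolds, a Hodge model `B` of a variety of dimension `m ≥ g`, a degree `k`, and one anchor `(A₀, Φ₀,
φ₀, hφ₀)`.  Then there is `r ≠ 0` such that for EVERY complex abelian variety `A` uniformised by
`φ : ℂᵍ/Φ(ℤ^ι) → A(ℂ)` (`hφ : IsAnalytification (Fin g → ℂ) A.X A.dim φ`) and every `hAm : A.dim ≤ m`, the
torus Hodge model of record `B₀ = ⟨Fin g → ℂ, ComplexTorus Φ, φ, hφ, e₀, …⟩ : HodgeModel A.dim A.X` satisfies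
`e₀ = r • inducedIso B B₀ hAm` in degree `k` on `ComplexTorus Φ`.  Obtained from
`exists_ne_zero_forall_torusModel_deRham_eq_smul_inducedIso` at the index `g` (anchor re-indexed by
`isAnalytification_pi_of_dim`, `AbelianVariety.isSmoothProjective_of_isAnalytification_pi`) and the index
transport `torusModel_deRham_eq_smul_inducedIso_of_dim_eq` along `g = A.dim`.
[cite: BottTu1982Forms, §I.5] [cite: MumfordAV1970, §4 (ii) and §6 Application 1 (p. 62)] -/
theorem exists_ne_zero_forall_abelianVariety_torusModel_deRham_eq_smul_inducedIso
    {e₀ : ComplexDeRhamIsoFamily (Fin g → ℂ)} (he₀ : e₀.IsNatural) (B : HodgeModel m Y) (hgm : g ≤ m)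
    (k : ℕ) (A₀ : AbelianVariety ℂ) (Φ₀ : (ι → ℝ) ≃L[ℝ] (Fin g → ℂ)) (φ₀ : ComplexTorus Φ₀ → A₀.Points ℂ)
    (hφ₀ : IsAnalytification (Fin g → ℂ) A₀.X A₀.dim φ₀) :
    ∃ r : ℂ, r ≠ 0 ∧ ∀ (A : AbelianVariety ℂ) (Φ : (ι → ℝ) ≃L[ℝ] (Fin g → ℂ))
      (φ : ComplexTorus Φ → A.Points ℂ) (hφ : IsAnalytification (Fin g → ℂ) A.X A.dim φ) (hAm : A.dim ≤ m)
      (y : complexDeRhamCohomology (Fin g → ℂ) (ComplexTorus Φ) k),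
      e₀ (ComplexTorus Φ) k y =
        r • HodgeModel.inducedIso B
          ({ model := Fin g → ℂ, carrier := ComplexTorus Φ, toComplexPoints := φ, isAnalytification := hφ,
             deRham := e₀, deRham_isNatural := he₀,
             isInternal_hodgePQ := Literature.Geometry.Kaehler.ComplexTorus.isInternal_hodgePQ Φ } :
            HodgeModel A.dim A.X) hAm (ComplexTorus Φ) k y := by
  classical
  obtain ⟨r, hr0, hr⟩ := exists_ne_zero_forall_torusModel_deRham_eq_smul_inducedIso he₀ B hgm k
    (AbelianVariety.isSmoothProjective_of_isAnalytification_pi hφ₀) Φ₀ φ₀ (isAnalytification_pi_of_dim hφ₀)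
  refine ⟨r, hr0, fun A Φ φ hφ hAm y ↦ ?_⟩
  have hdim : g = A.dim := (AbelianVariety.dim_eq_of_isAnalytification_pi hφ).symm
  exact torusModel_deRham_eq_smul_inducedIso_of_dim_eq B φ (isAnalytification_pi_of_dim hφ) e₀ he₀
    (Literature.Geometry.Kaehler.ComplexTorus.isInternal_hodgePQ Φ) hdim hgm hAm k (hr A.X Φ φ _) y

end Uniform

end Literature.AlgebraicGeometry.HodgeTheory

end
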